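import Summits.QuantumFields.YangMills.Theorems.AllWindowsColdBoxBoxHighLineLandauBallCoercivity
import Summits.QuantumFields.YangMills.Theorems.AllWindowsColdBoxBoxHighLineDirichletCapacity
import Literature.MathematicalPhysics.QuantumFieldTheory.Federbush1986.PureAveragesSU2Lemma12

/-!
# Preliminaries for J5a′ (`…LandauBallCapacity`): the exact per-edge linearisation of `Im q(W_e) − Im q(V_e)` on the gauge ball, divergence
# bookkeeping, and the bi-Laplacian capacity of a site for `Im ℍ`-valued fields

Width seat `ym-line-sfw-p2-w2` (prover-ym-line-sfw-p2-w2-g32-0); recorded lift L1 of the next rung U5 (`Cruxes/BoxWindowHighSU2213/U5-BLOCKERS.md` §1 B1,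
planner ym-idea-2 g18), source (γ) of the honest window count (bus ym-idea-1 2026-08-29T22:01Z).  In ✓4ℓ's letters (`ψ_x = q(h_x)` unit quaternions,
`φ = Im ψ`, `F_e = Im q(W_e) − Im q(V_e)`, `W_e = h_x V_e h_y⁻¹`):

* `LandauBallCapacity.im_mul_star_eq` — the EXACT identity `Im (x ȳ) = Im x − Im y + Im ((x − 1)(y − x)^*)` for unit `x` (`x x^* = 1`);
* `LandauBallCapacity.norm_im_transform_sub_linear_le` / `norm_sq_im_transform_sub_linear_le` — with ✓`transform_sub_eq`/✓`norm_remainder_le`: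
  `‖Im(x V ȳ − V) − (Im x − Im y)‖ ≤ ‖x − 1‖‖y − x‖ + ‖V − 1‖(‖x − 1‖ + ‖y − 1‖)`, and `≤ 18 r²(‖x − 1‖² + ‖y − 1‖²)` squared when `‖V − 1‖ ≤ r`,
  `‖x − y‖ ≤ 2r` — the per-edge remainder of the linearisation `F_e = (φ_x − φ_y) + E_e` is `O(r·‖ψ − 1‖)`;
* `LandauBallCapacity.norm_sum_sub_sq_le`, `sum_norm_div_sq_le` — `Σ_{x interior} ‖Σ_μ (E(x,μ) − E(x−e_μ,μ))‖² ≤ 16 Σ_{e ∈ box} ‖E e‖²`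
  (✓`sum_edges_eq_sum_interior_out/in`);
* ★ `LandauBallCapacity.norm_sq_le_capacity_lap` — for a site field `θ` with values in `Im ℍ` vanishing off the interior and `x₀` interior,
  `‖θ x₀‖² ≤ C (1 + log H)⁴ · Σ_{x interior} ‖(−Δ_D θ)(x)‖²`, `(−Δ_D θ)(x) = Σ_μ ((θ x − θ(x+e_μ)) − (θ(x−e_μ) − θ x))` — componentwise
  ✓`Capacity.sq_apply_le_mul_normSq_dirichlet` (the bi-Laplacian capacity of a point in `d = 4`) through ✓`mulVec_dirichletMatrix` /
  ✓`latticeLaplacianZd_def` on the zero extension.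

Everything proved; no definitions; Mathlib + tree only; standard axioms.  HONEST LABEL: deterministic preliminaries of a glue brick for the recorded lift
L1 of the NEXT rung U5 (LINE-20 ⟨stmt-QuantumFields-24336⟩, unstaffed, gated by the critic's N2/I23); S5, U5, ⟨24004⟩ ⟨24335⟩ ⟨24336⟩ remain OPEN;
no stub is closed by name; no crux, rung or summit is proved; **the Yang–Mills mass gap is NOT proved by this file; no summit is proved by a line.**
-/

set_option autoImplicit false

noncomputable section

open Matrix Finset Quaternion
open Literature.MathematicalPhysics.QuantumFieldTheory.Federbush1986.SU2 (norm_im_le)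
open Literature.MathematicalPhysics.QuantumFieldTheory.AxialGauge (boxEdges)
open Literature.MathematicalPhysics.QuantumLattice (su2Quat norm_su2Quat gaugeTransformZd LGConfig ZdEdge)
open Literature.Probability.LatticeModels (Site dirichletMatrix zeroExtend zeroExtend_of_mem zeroExtend_of_not_mem mulVec_dirichletMatrix
  latticeLaplacianZd_def)
open Summit.QuantumFields.YangMills.Theorems.AllWindowsColdBoxBoxHighLine.LandauBall

namespace Summit.QuantumFields.YangMills.Theorems.AllWindowsColdBoxBoxHighLine

namespace LandauBallCapacity

variable {H : ℕ}

/-! ## Quaternion preliminaries: the exact linearisation of `Im (x ȳ)` -/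

/-- **Exact linearisation**: for a unit quaternion `x`, `Im (x ȳ) = Im x − Im y + Im ((x − 1)(y − x)^*)` (since `x x^* = 1` is real). -/
theorem im_mul_star_eq {x : ℍ} (y : ℍ) (hx : ‖x‖ = 1) :
    (x * star y).im = x.im - y.im + ((x - 1) * star (y - x)).im := by
  have hxx : x * star x = 1 := by
    rw [Quaternion.self_mul_star, Quaternion.normSq_eq_norm_mul_self, hx, mul_one, Quaternion.coe_one]
  have hexp : (x - 1) * star (y - x) = x * star y - 1 - star y + star x := by
    rw [star_sub]
    have : (x - 1) * (star y - star x) = x * star y - x * star x - star y + star x := by noncomm_ring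
    rw [this, hxx]
  rw [hexp]
  simp only [im_sub, im_add, Quaternion.im_star, Quaternion.im_one]
  abel

/-- **Per-edge linearisation with remainder**: for unit `x, y` and any `V`, with `W = x V ȳ`,
`‖Im (W − V) − (Im x − Im y)‖ ≤ ‖x − 1‖·‖y − x‖ + ‖V − 1‖·(‖x − 1‖ + ‖y − 1‖)`. -/
theorem norm_im_transform_sub_linear_le {x y : ℍ} (V : ℍ) (hx : ‖x‖ = 1) (hy : ‖y‖ = 1) :
    ‖(x * V * star y - V).im - (x.im - y.im)‖ ≤ ‖x - 1‖ * ‖y - x‖ + ‖V - 1‖ * (‖x - 1‖ + ‖y - 1‖) := by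
  rw [transform_sub_eq, im_add, im_sub, Quaternion.im_one, sub_zero, im_mul_star_eq y hx]
  have h1 : ‖((x - 1) * star (y - x)).im‖ ≤ ‖x - 1‖ * ‖y - x‖ := by
    refine (norm_im_le _).trans ?_
    rw [norm_mul, norm_star]
  have h2 : ‖((x - 1) * (V - 1) * star y + (V - 1) * (star y - 1)).im‖ ≤ ‖V - 1‖ * (‖x - 1‖ + ‖y - 1‖) :=
    (norm_im_le _).trans (LandauBall.norm_remainder_le x V hy)
  calc ‖x.im - y.im + ((x - 1) * star (y - x)).im + ((x - 1) * (V - 1) * star y + (V - 1) * (star y - 1)).im - (x.im - y.im)‖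
      = ‖((x - 1) * star (y - x)).im + ((x - 1) * (V - 1) * star y + (V - 1) * (star y - 1)).im‖ := by
        congr 1; abel
    _ ≤ ‖((x - 1) * star (y - x)).im‖ + ‖((x - 1) * (V - 1) * star y + (V - 1) * (star y - 1)).im‖ := norm_add_le _ _
    _ ≤ ‖x - 1‖ * ‖y - x‖ + ‖V - 1‖ * (‖x - 1‖ + ‖y - 1‖) := add_le_add h1 h2

/-- **Squared per-edge remainder on the gauge ball**: if moreover `‖V − 1‖ ≤ r` and `‖x − y‖ ≤ 2r`, then
`‖Im (W − V) − (Im x − Im y)‖² ≤ 18 r² (‖x − 1‖² + ‖y − 1‖²)`. -/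
theorem norm_sq_im_transform_sub_linear_le {x y V : ℍ} {r : ℝ} (hx : ‖x‖ = 1) (hy : ‖y‖ = 1) (hV : ‖V - 1‖ ≤ r)
    (hxy : ‖x - y‖ ≤ 2 * r) :
    ‖(x * V * star y - V).im - (x.im - y.im)‖ ^ 2 ≤ 18 * r ^ 2 * (‖x - 1‖ ^ 2 + ‖y - 1‖ ^ 2) := by
  have h := norm_im_transform_sub_linear_le V hx hy
  set a := ‖x - 1‖
  set b := ‖y - 1‖
  have ha : 0 ≤ a := norm_nonneg _
  have hb : 0 ≤ b := norm_nonneg _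
  have hr : 0 ≤ r := (norm_nonneg _).trans hV
  have hyx : ‖y - x‖ ≤ 2 * r := by rw [norm_sub_rev]; exact hxy
  have h3 : ‖(x * V * star y - V).im - (x.im - y.im)‖ ≤ 3 * r * (a + b) := by
    calc _ ≤ a * ‖y - x‖ + ‖V - 1‖ * (a + b) := h
      _ ≤ a * (2 * r) + r * (a + b) := add_le_add (mul_le_mul_of_nonneg_left hyx ha) (mul_le_mul_of_nonneg_right hV (by positivity))
      _ ≤ 3 * r * (a + b) := by nlinarith
  have h0 : 0 ≤ ‖(x * V * star y - V).im - (x.im - y.im)‖ := norm_nonneg _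
  calc ‖(x * V * star y - V).im - (x.im - y.im)‖ ^ 2 ≤ (3 * r * (a + b)) ^ 2 := pow_le_pow_left₀ h0 h3 2
    _ = 9 * r ^ 2 * (a + b) ^ 2 := by ring
    _ ≤ 18 * r ^ 2 * (a ^ 2 + b ^ 2) := by nlinarith [sq_nonneg (a - b), sq_nonneg r]

/-! ## Sums: the divergence of an edge field and the bi-Laplacian capacity of a site, componentwise on `Im ℍ` -/

/-- `‖Σ_{μ<4} (u_μ − v_μ)‖² ≤ 8·Σ_μ (‖u_μ‖² + ‖v_μ‖²)`. -/
theorem norm_sum_sub_sq_le (u v : Fin 4 → ℍ) :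
    ‖∑ μ : Fin 4, (u μ - v μ)‖ ^ 2 ≤ 8 * ∑ μ : Fin 4, (‖u μ‖ ^ 2 + ‖v μ‖ ^ 2) := by
  have h1 : ‖∑ μ : Fin 4, (u μ - v μ)‖ ≤ ∑ μ : Fin 4, (‖u μ‖ + ‖v μ‖) :=
    (norm_sum_le _ _).trans (Finset.sum_le_sum fun μ _ => norm_sub_le _ _)
  have h0 : 0 ≤ ‖∑ μ : Fin 4, (u μ - v μ)‖ := norm_nonneg _
  have cs : ∀ s : Fin 4 → ℝ, (∑ μ : Fin 4, s μ) ^ 2 ≤ 4 * ∑ μ : Fin 4, s μ ^ 2 := fun s => by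
    simp only [Fin.sum_univ_four]
    nlinarith [sq_nonneg (s 0 - s 1), sq_nonneg (s 0 - s 2), sq_nonneg (s 0 - s 3), sq_nonneg (s 1 - s 2), sq_nonneg (s 1 - s 3),
      sq_nonneg (s 2 - s 3)]
  calc ‖∑ μ : Fin 4, (u μ - v μ)‖ ^ 2 ≤ (∑ μ : Fin 4, (‖u μ‖ + ‖v μ‖)) ^ 2 := pow_le_pow_left₀ h0 h1 2
    _ ≤ 4 * ∑ μ : Fin 4, (‖u μ‖ + ‖v μ‖) ^ 2 := cs _
    _ ≤ 4 * ∑ μ : Fin 4, (2 * (‖u μ‖ ^ 2 + ‖v μ‖ ^ 2)) :=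
        mul_le_mul_of_nonneg_left (Finset.sum_le_sum fun μ _ => by nlinarith [sq_nonneg (‖u μ‖ - ‖v μ‖)]) (by norm_num)
    _ = 8 * ∑ μ : Fin 4, (‖u μ‖ ^ 2 + ‖v μ‖ ^ 2) := by rw [← Finset.mul_sum]; ring

/-- **Divergence bookkeeping**: for an edge field `E`, `Σ_{x interior} ‖Σ_μ (E(x,μ) − E(x−e_μ,μ))‖² ≤ 16·Σ_{e ∈ box} ‖E e‖²`
(every box edge is the out-edge of at most one interior site and the in-edge of at most one). -/
theorem sum_norm_div_sq_le (E : ZdEdge 4 → ℍ) :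
    ∑ x ∈ interiorSites H, ‖∑ μ : Fin 4, (E (x, μ) - E (x - Pi.single μ 1, μ))‖ ^ 2 ≤
      16 * ∑ e ∈ boxEdges 4 (2 * H + 1), ‖E e‖ ^ 2 := by
  classical
  -- out-edges
  have hout := sum_edges_eq_sum_interior_out (H := H) (fun e => if e.1 ∈ interiorSites H then ‖E e‖ ^ 2 else 0)
    (fun e he => if_neg he)
  have hout' : ∑ x ∈ interiorSites H, ∑ μ : Fin 4, ‖E (x, μ)‖ ^ 2 ≤ ∑ e ∈ boxEdges 4 (2 * H + 1), ‖E e‖ ^ 2 := by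
    have h1 : ∑ x ∈ interiorSites H, ∑ μ : Fin 4, ‖E (x, μ)‖ ^ 2 =
        ∑ x ∈ interiorSites H, ∑ μ : Fin 4, (if (x, μ).1 ∈ interiorSites H then ‖E (x, μ)‖ ^ 2 else 0) :=
      Finset.sum_congr rfl fun x hx => Finset.sum_congr rfl fun μ _ => by rw [if_pos hx]
    rw [h1, ← hout]
    exact Finset.sum_le_sum fun e _ => by
      split_ifs
      · exact le_rfl
      · positivity
  -- in-edges
  have hin := sum_edges_eq_sum_interior_in (H := H) (fun e => if e.1 + Pi.single e.2 1 ∈ interiorSites H then ‖E e‖ ^ 2 else 0)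
    (fun e he => if_neg he)
  have hin' : ∑ x ∈ interiorSites H, ∑ μ : Fin 4, ‖E (x - Pi.single μ 1, μ)‖ ^ 2 ≤ ∑ e ∈ boxEdges 4 (2 * H + 1), ‖E e‖ ^ 2 := by
    have h1 : ∑ x ∈ interiorSites H, ∑ μ : Fin 4, ‖E (x - Pi.single μ 1, μ)‖ ^ 2 =
        ∑ x ∈ interiorSites H, ∑ μ : Fin 4,
          (if (x - Pi.single μ 1, μ).1 + Pi.single (x - Pi.single μ 1, μ).2 1 ∈ interiorSites H then ‖E (x - Pi.single μ 1, μ)‖ ^ 2 else 0) :=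
      Finset.sum_congr rfl fun x hx => Finset.sum_congr rfl fun μ _ => by
        rw [if_pos (by simpa using hx)]
    rw [h1, ← hin]
    exact Finset.sum_le_sum fun e _ => by
      split_ifs
      · exact le_rfl
      · positivity
  calc ∑ x ∈ interiorSites H, ‖∑ μ : Fin 4, (E (x, μ) - E (x - Pi.single μ 1, μ))‖ ^ 2
      ≤ ∑ x ∈ interiorSites H, 8 * ∑ μ : Fin 4, (‖E (x, μ)‖ ^ 2 + ‖E (x - Pi.single μ 1, μ)‖ ^ 2) :=
        Finset.sum_le_sum fun x _ => norm_sum_sub_sq_le _ _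
    _ = 8 * (∑ x ∈ interiorSites H, ∑ μ : Fin 4, ‖E (x, μ)‖ ^ 2 + ∑ x ∈ interiorSites H, ∑ μ : Fin 4, ‖E (x - Pi.single μ 1, μ)‖ ^ 2) := by
        rw [← Finset.sum_add_distrib, Finset.mul_sum]
        refine Finset.sum_congr rfl fun x _ => ?_
        rw [← Finset.sum_add_distrib]
    _ ≤ 8 * (∑ e ∈ boxEdges 4 (2 * H + 1), ‖E e‖ ^ 2 + ∑ e ∈ boxEdges 4 (2 * H + 1), ‖E e‖ ^ 2) := by gcongr
    _ = 16 * ∑ e ∈ boxEdges 4 (2 * H + 1), ‖E e‖ ^ 2 := by ring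

/-- **Capacity of a site for `Im ℍ`-valued fields** (componentwise ✓`Capacity.sq_apply_le_mul_normSq_dirichlet`): there is `C ≥ 0` such that for
`H ≥ 1`, every site field `θ` with values in `Im ℍ` vanishing off the interior, and every interior `x₀`,
`‖θ x₀‖² ≤ C (1 + log H)⁴ · Σ_{x interior} ‖(−Δ_D θ)(x)‖²`, `(−Δ_D θ)(x) = Σ_μ ((θ x − θ(x+e_μ)) − (θ(x−e_μ) − θ x))`. -/
theorem norm_sq_le_capacity_lap : ∃ C : ℝ, 0 ≤ C ∧ ∀ H : ℕ, 1 ≤ H → ∀ θ : Site 4 → ℍ,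
    (∀ x, x ∉ interiorSites H → θ x = 0) → (∀ x, (θ x).re = 0) → ∀ x₀ ∈ interiorSites H,
      ‖θ x₀‖ ^ 2 ≤ C * (1 + Real.log H) ^ 4 *
        ∑ x ∈ interiorSites H, ‖∑ μ : Fin 4, ((θ x - θ (x + Pi.single μ 1)) - (θ (x - Pi.single μ 1) - θ x))‖ ^ 2 := by
  obtain ⟨C, hC, hcap⟩ := Capacity.sq_apply_le_mul_normSq_dirichlet
  refine ⟨C, hC, fun H hH θ hθ0 hre x₀ hx₀ => ?_⟩
  set lap : Site 4 → ℍ := fun x => ∑ μ : Fin 4, ((θ x - θ (x + Pi.single μ 1)) - (θ (x - Pi.single μ 1) - θ x)) with hlap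
  have hH' : (1 : ℝ) ≤ H := by exact_mod_cast hH
  have hL4 : 0 ≤ C * (1 + Real.log H) ^ 4 := mul_nonneg hC (pow_nonneg (add_nonneg zero_le_one (Real.log_nonneg hH')) 4)
  -- one component, for an arbitrary additive functional `π`
  have hcomp : ∀ π : ℍ →+ ℝ, (π (θ x₀)) ^ 2 ≤ C * (1 + Real.log H) ^ 4 * ∑ x ∈ interiorSites H, (π (lap x)) ^ 2 := by
    intro π
    set f : ↥(interiorSites H) → ℝ := fun y => π (θ y) with hf
    have hz : zeroExtend (interiorSites H) f = fun z => π (θ z) := by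
      funext z
      by_cases hz : z ∈ interiorSites H
      · rw [zeroExtend_of_mem _ hz]
      · rw [zeroExtend_of_not_mem _ hz, hθ0 z hz, map_zero]
    have hΔ : ∀ y : ↥(interiorSites H), (dirichletMatrix (interiorSites H) *ᵥ f) y = π (lap y) := by
      intro y
      rw [mulVec_dirichletMatrix, hz, latticeLaplacianZd_def]
      simp only [hlap, map_sub, map_add, Fin.sum_univ_four]
      push_cast
      ring
    have h := hcap H hH f ⟨x₀, hx₀⟩
    have hsum : (dirichletMatrix (interiorSites H) *ᵥ f) ⬝ᵥ (dirichletMatrix (interiorSites H) *ᵥ f) =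
        ∑ x ∈ interiorSites H, (π (lap x)) ^ 2 := by
      rw [dotProduct, ← Finset.sum_coe_sort (interiorSites H) (fun x => (π (lap x)) ^ 2)]
      exact Finset.sum_congr rfl fun y _ => by rw [hΔ y, sq]
    rw [hsum] at h
    exact h
  -- the three imaginary components
  let pI : ℍ →+ ℝ := { toFun := fun q => q.imI, map_zero' := rfl, map_add' := fun _ _ => rfl }
  let pJ : ℍ →+ ℝ := { toFun := fun q => q.imJ, map_zero' := rfl, map_add' := fun _ _ => rfl }
  let pK : ℍ →+ ℝ := { toFun := fun q => q.imK, map_zero' := rfl, map_add' := fun _ _ => rfl }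
  let pR : ℍ →+ ℝ := { toFun := fun q => q.re, map_zero' := rfl, map_add' := fun _ _ => rfl }
  have hI := hcomp pI
  have hJ := hcomp pJ
  have hK := hcomp pK
  have hlre : ∀ x, (lap x).re = 0 := by
    intro x
    have : pR (lap x) = 0 := by
      simp only [hlap, map_sum, map_sub]
      show ∑ μ : Fin 4, ((θ x).re - (θ (x + Pi.single μ 1)).re - ((θ (x - Pi.single μ 1)).re - (θ x).re)) = 0
      simp [hre]
    exact this
  have hθsq : ‖θ x₀‖ ^ 2 = (pI (θ x₀)) ^ 2 + (pJ (θ x₀)) ^ 2 + (pK (θ x₀)) ^ 2 := LandauBallCoercive.norm_sq_of_re_eq_zero (hre x₀)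
  have hlsq : ∀ x, ‖lap x‖ ^ 2 = (pI (lap x)) ^ 2 + (pJ (lap x)) ^ 2 + (pK (lap x)) ^ 2 := fun x => LandauBallCoercive.norm_sq_of_re_eq_zero (hlre x)
  rw [hθsq]
  calc (pI (θ x₀)) ^ 2 + (pJ (θ x₀)) ^ 2 + (pK (θ x₀)) ^ 2
      ≤ C * (1 + Real.log H) ^ 4 * ∑ x ∈ interiorSites H, (pI (lap x)) ^ 2 +
          C * (1 + Real.log H) ^ 4 * ∑ x ∈ interiorSites H, (pJ (lap x)) ^ 2 +
          C * (1 + Real.log H) ^ 4 * ∑ x ∈ interiorSites H, (pK (lap x)) ^ 2 := add_le_add (add_le_add hI hJ) hK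
    _ = C * (1 + Real.log H) ^ 4 * ∑ x ∈ interiorSites H, ‖lap x‖ ^ 2 := by
        rw [← mul_add, ← mul_add, ← Finset.sum_add_distrib, ← Finset.sum_add_distrib]
        congr 1
        exact Finset.sum_congr rfl fun x _ => (hlsq x).symm

end LandauBallCapacity

end Summit.QuantumFields.YangMills.Theorems.AllWindowsColdBoxBoxHighLine

end
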